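import Literature.MathematicalPhysics.QuantumFieldTheory.Balaban1983to89.B8Thm4ConcreteLanE
import Literature.MathematicalPhysics.QuantumFieldTheory.Balaban1983to89.B8LeafModelZd3

/-!
# `Balaban1983to89.B8Thm4CoreZd3LanE` — [Balaban1985RegularSpaces] THEOREM 4 (p. 88) ∕ THEOREM 8 (p. 101): THE THEOREM-4-SHAPED CORE AT NODE 00's
# CARRIER OF RECORD `B8LeafModelZd3.zdGF3` FOR A SOURCE-INDEXED GAUGE PREDICATE, PROPOSITION 5's UNIQUENESS SOCKET IN THE REPAIRED («E») CURRENCY —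
# this seat's g4 `B8Thm4CoreZd3Lan.thm4Core_zd3_lan` VERBATIM on `B8Thm4ConcreteLanE.thm4Body_concrete_uniform_lanE` (the member-ised `SP5u` binder
# := `B8LeafModelZdSockP5uE.SockP5uE`'s text at `LanF i U₀ φ i.k`, (1.62)-constant `5dL·B₈(α₀ + α₁)`); same conclusion, same proof

statement-level skeleton of published theorems with citation tags; proofs where landed; nothing here is a claim about the Yang–Mills mass gap

T. Bałaban, *Spaces of regular gauge field configurations on a lattice and gauge fixing conditions*, Commun. Math. Phys. **99** (1985) 75–102
`[Balaban1985RegularSpaces]` ("B8"; journal page = PDF page + 74): Thm 4 p. 88, (1.37)–(1.38) p. 82, (1.62) p. 87, Sect. H p. 101 (Thm 8, (1.146)).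

## WHY THIS FILE (cell `pub-ymgap`, HUMAN RULING D-0062; R134 seat `pub-ymgap-dag-n05-c` g6, DAG node N05 = [B8]; count-neutral)

The second of the three consumer re-knits dag-n05-d g5 asked this seat for (bus 2026-08-27T07:29Z, INTENT-5 (3)): the PRE-E tower-local `SP5u` binder of
the g4 `_lan` chain has no provider of record (dag-n04-b g5's located point; n05-a g7's E repair `B8Thm4UniqueE` ∕ `B8Thm4ConcreteE` ∕ `SockP5uE`), so
the chain is re-threaded on the E text: `B8Thm4ConcreteLanE` (concrete driver) → THIS FILE (core at `zdGF3`) → `B8Thm8SurvivingZd3HE` (Theorem 8 surviving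
at `zdGF3H`).  Relative to `B8Thm4CoreZd3Lan`: the binder `SP5u` is `SockP5uE`'s text member-ised (`Ω ↦ i.Ω`, `Λs k ↦ i.Λs i.k`, `η ↦ i.η`, `k ↦ i.k`) with
`IsLandau138W … W ↦ LanF i U₀ φ i.k W`, the source premiss `∀ φ, Adm i φ U₀ α₀ α₁ →` after the unitarity of `U′`, and the (1.62)-constant
`5dL·B₈(α₀ + α₁)`; the one lemma name `thm4Body_concrete_uniform_lan ↦ thm4Body_concrete_uniform_lanE`; nothing else.

ORIGINAL g4 RATIONALE (kept).  Third brick of the N05 knit's printed member `t8S : B8Thm8Surviving.Thm8SurvivingAt 1 …` (after `B8Prop3GaugeFixedKLevelSrc`, `B8Thm4ConcreteLan`).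
n05-a's `thm4Printed_zd3` turns the concrete Theorem 4 into the leaf predicate `B8.Thm4Printed` at the carrier `zdGF3` (unfolding the fields;
(1.37) `C137` on the canonical exponent `mlogCfg` of the gauge-fixed field via the (1.42) lemma `B8Eq142KLevelLocal.H42_of_inAx`, itself
`Lan`-generic).  THIS FILE does the same for the source-indexed concrete theorem, with the conclusion SPELLED OUT in the carrier's fields (there
is no abstract leaf predicate for the sourced Theorem 4): for every member `i`, every `α₀, α₁` below ONE threshold, every `(U₀, P)` with the
carrier's (1.33) `InA`, (1.34) `InAAx`, (1.35)+(1.66)₀ `avgClose166`, and every admitted source `φ` — a restricted `u : (zdGF3 …).GT` with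
(1.37) `C137 α₁`, the gauge condition `LanF i U₀ φ k` for the gauge-fixed field, the (1.62)-shape `C162 (5dL·B₈) (α₀ + α₁)`, and equality of
every restricted competitor with the gauge condition and the (1.62)-shape.  READING for Theorem 8 (p. 101): `Φ := Site d → 𝔸`,
`LanF i U₀ f i.k W := B8Eq138LandauZd.IsLandau146W L i.k i.η (i.Ω 0) (i.Λs i.k) U₀ f W` = the carrier's `LandauF U₀ f` (1.146), `Adm i f U₀ α₀ α₁ :=`
the carrier's `InR U₀ f` ∧ `fNorm f ≤ γ(α₀ + α₁)`; the surviving form's remaining pieces — print's hypotheses (1.33)–(1.35) WITHOUT (1.66)₀ on the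
`Ω₀ = ℤᵈ` members via (1.65) (`B8Ineq166Univ`, as in `B8LeafModelZd3Thm2`), and the conditional (1.36)∕(1.39) members via a sourced
Proposition 3 — are the NEXT brick (located), not this file.

## HONEST SCOPE

An assembly BY NAME (n05-a's proof with the `_lan` concrete theorem); NO estimate proved anew; the four sockets (Prop. 5 ∃ at `LanF` — base and
step —, the SOURCED b9 in-edge `+ γ′B₀(α₀ + α₁)`, Prop. 5's uniqueness at `LanF` in the E currency) are HYPOTHESES per member whose sourced
providers are dag-n05-d g5's lineage (modulo [4]'s letters).  `d ≥ 2`; `T_η ↦ ℤᵈ`; `≤` for print's `<`.  Count-neutral; N05 NOT discharged; one finite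
`T⁴` programme at fixed `ε`, Bałaban as printed — nothing continuum ∕ ℝ⁴ ∕ OS ∕ mass-gap ∕ Clay.  No `sorry`, no `axiom`, no definition, no `instance`.
Unit `pub-ymgap-dag-n05-c` (g6), 2026-08-27.

[cite: Balaban1985RegularSpaces, Thm 8 (1.146) p.101, Thm 4 p.88, (1.29) p.81, (1.37)–(1.38) p.82, (1.62) p.87, Prop. 5 (1.108)–(1.109) p.94, pp.94–95]
-/

noncomputable section

open NormedSpace

namespace Literature.MathematicalPhysics.QuantumFieldTheory.Balaban1983to89.B8Thm4CoreZd3LanE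

open Complex (I)
open MatrixLog B7Prop1Explicit B7Prop2Explicit B7Prop1Local B7Eq92Concrete
open B7Prop2Explicit (C0 c2')
open B7Prop3Flat (c3)
open B8Ineq132 (covDerivFwd InAk)
open B8Eq119TwistedAxial (Restr129 InAx)
open B8Eq184Proof (gaugeExp cfgExp)
open B8Lemma1NonAbelian (mulCfg)
open B8Eq140Level (SideTouches)
open B8Eq146AExpansion (iEta)
open B7Prop4GeneralLevels (logCovIter linCovIter)
open B8Eq155JBound (Jcur wsup)
open B8ScaledSupNorm (bondNorm msup)
open B8Thm2LogB (blockTop)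
open B8Ineq130 (tlo thi)
open B8Eq138LandauZd (logCfg)
open B8Prop3GaugeFixedKLevel (mem_unitaryUnits_of_mgauge_eq)
open B8Thm4AtLandau138 (mgauge_mgauge_inv)
open B8Thm4ConcreteLanE (thm4Body_concrete_uniform_lanE)
open B8Thm4Windows (thm4_windows thm4_windows_extra)
open B8LeafModelZd (ZdIdx)
open B8LeafModelZd3 (zdGF3 mlogCfg mlogCfg_spec)

-- `Site` alone could resolve to the torus sites of `Setup.lean`; re-export the `ℤ^d` sites of `B7Prop1Explicit`.
export B7Prop1Explicit (Site)

variable {d : ℕ}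

section Core

variable {𝔸 : Type} [CStarAlgebra 𝔸] [Nontrivial 𝔸]

/-- **THEOREM 4 ∕ THEOREM 8, THE THEOREM-4-SHAPED CORE AT THE CARRIER OF RECORD `zdGF3`, SOURCE-INDEXED GAUGE PREDICATE, PROPOSITION 5's UNIQUENESS SOCKET IN
THE REPAIRED («E») CURRENCY** (module docstring; `B8Thm4CoreZd3Lan.thm4Core_zd3_lan` with the binder `SP5u` := `SockP5uE`'s text member-ised at `LanF i`):
for `d, L ≥ 2`, the [4] constant `B₀ > 0`, `B₀′ > 0`, Prop. 5's radius `cu > 0`, the providers' threshold `cP > 0`, source constants `γ′ ≥ 0` and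
`B₈ ≥ B₀` with `5dLB₀ + 2γ′B₀ ≤ 5dLB₈`, `2 ≤ 5dLB₈`, any Hölder data `β, len` — MODULO, at every member `i`, the sourced sockets `SP5base` ∕
`SP5` (Prop. 5 at `LanF i`), `SH59src` ([4] Thm 3.3 + (1.57)–(1.58) with source, `+ γ′B₀(α₀ + α₁)`), `SP5u` (Prop. 5's uniqueness at `LanF i`):
ONE threshold `c₁` such that the carrier's (1.33) ∕ (1.34) ∕ (1.35)+(1.66)₀ at `(α₀, α₁)` and an admitted source `φ` give a restricted `u` with
(1.37) `C137 α₁`, `LanF i U₀ φ i.k` for `U′^{u⁻¹}`, the (1.62)-shape `C162 (5dL·B₈) (α₀ + α₁)`, unique among restricted competitors with the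
gauge condition and the (1.62)-shape.  n05-a's `B8LeafModelZd3.thm4Printed_zd3` VERBATIM on `B8Thm4ConcreteLanE.thm4Body_concrete_uniform_lanE`;
(1.37) by `B8Eq142KLevelLocal.H42_of_inAx` at `Lan := LanF i U₀ φ`. [cite: Balaban1985RegularSpaces, Thm 8 (1.146) p.101, Thm 4 p.88, (1.29) p.81, (1.37)–(1.38) p.82, (1.62) p.87, Prop. 5 p.94, pp.94–95] -/
theorem thm4Core_zd3_lanE (hd2 : 2 ≤ d) {L : ℕ} (hL : 2 ≤ L) {β : ℝ} {len : Site d → ℝ} {B₀ B₀' cu cP : ℝ} (hB₀ : 0 < B₀)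
    (hB₀' : 0 < B₀') (hcu : 0 < cu) (hcP : 0 < cP)
    {Φ : Type*} {γ' B₈ : ℝ} (hγ' : 0 ≤ γ') (hB₈ : 0 < B₈) (hB₀8 : B₀ ≤ B₈) (hB : 2 ≤ 5 * (d : ℝ) * L * B₈)
    (hγB : 5 * (d : ℝ) * L * B₀ + 2 * (γ' * B₀) ≤ 5 * (d : ℝ) * L * B₈)
    (Adm : ZdIdx d L → Φ → (Site d → Fin d → 𝔸ˣ) → ℝ → ℝ → Prop)
    (LanF : ZdIdx d L → (Site d → Fin d → 𝔸ˣ) → Φ → ℕ → (Site d → Fin d → 𝔸ˣ) → Prop)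
    (SP5base : ∀ i : ZdIdx d L, ∀ α₀ α₁ : ℝ, 0 < α₀ → 0 < α₁ → α₀ + α₁ ≤ cP →
      ∀ U₀ U' : Site d → Fin d → 𝔸ˣ, (∀ x κ, U₀ x κ ∈ unitaryUnits 𝔸) → (∀ x κ, U' x κ ∈ unitaryUnits 𝔸) →
      ∀ φ : Φ, Adm i φ U₀ α₀ α₁ →
      InAk L i.k i.η α₀ i.Ω U₀ → InAk L i.k i.η α₀ i.Ω (mulCfg U' U₀) → (∀ m, m ≤ i.k → InAx L m (i.Λs m) U₀ (mulCfg U' U₀)) →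
      (∀ j, j ≤ i.k → ∀ (z : Site d) (μ : Fin d), (∀ x, InBox (loK L j z) (bondHiK L j z μ) x → x ∈ i.Ω j) →
        ‖(avgIter L (mulCfg U' U₀) j z μ : 𝔸) - (avgIter L U₀ j z μ : 𝔸)‖ ≤ α₁) →
      (∀ b ∈ {b : Site d × Fin d | SideTouches (i.Ω 0) b.1 b.2}, ‖((U' b.1 b.2 : 𝔸ˣ) : 𝔸) - 1‖ ≤ α₁) →
      (∃ (v : Site d → 𝔸ˣ) (lam : Site d → 𝔸), (∀ x, v x ∈ unitaryUnits 𝔸) ∧ (∀ x, x ∉ i.Ω 0 → v x = 1) ∧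
        (∀ j, j ≤ 1 → ∀ b ∈ {b : Site d × Fin d | SideTouches (i.Ω j) b.1 b.2}, (v b.1 : 𝔸) = ((gaugeExp lam b.1 : 𝔸ˣ) : 𝔸) ∧
        (v (b.1 + e b.2) : 𝔸) = ((gaugeExp lam (b.1 + e b.2) : 𝔸ˣ) : 𝔸)) ∧
        (∀ j, j ≤ 1 → ∀ b ∈ {b : Site d × Fin d | SideTouches (i.Ω j) b.1 b.2},
        ‖lam b.1‖ ≤ (8 * B₀' * (5 * (d : ℝ) * L * B₈) * (α₀ + α₁)) ∧ ((L : ℝ) ^ j * i.η) * ‖covDerivFwd i.η U₀ b.2 lam b.1‖ ≤ (8 * B₀' * (5 * (d : ℝ) * L * B₈) * (α₀ + α₁))) ∧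
        LanF i U₀ φ 1 (mgauge U₀ v⁻¹ U') ∧ Restr129 L 1 (i.Λs 1) U₀ ((1 : Site d → 𝔸ˣ) * v)))
    (SP5 : ∀ i : ZdIdx d L, ∀ α₀ α₁ : ℝ, 0 < α₀ → 0 < α₁ → α₀ + α₁ ≤ cP →
      ∀ U₀ U' : Site d → Fin d → 𝔸ˣ, (∀ x κ, U₀ x κ ∈ unitaryUnits 𝔸) → (∀ x κ, U' x κ ∈ unitaryUnits 𝔸) →
      ∀ φ : Φ, Adm i φ U₀ α₀ α₁ →
      InAk L i.k i.η α₀ i.Ω U₀ → InAk L i.k i.η α₀ i.Ω (mulCfg U' U₀) → (∀ m, m ≤ i.k → InAx L m (i.Λs m) U₀ (mulCfg U' U₀)) →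
      (∀ j, j ≤ i.k → ∀ (z : Site d) (μ : Fin d), (∀ x, InBox (loK L j z) (bondHiK L j z μ) x → x ∈ i.Ω j) →
        ‖(avgIter L (mulCfg U' U₀) j z μ : 𝔸) - (avgIter L U₀ j z μ : 𝔸)‖ ≤ α₁) →
      (∀ b ∈ {b : Site d × Fin d | SideTouches (i.Ω 0) b.1 b.2}, ‖((U' b.1 b.2 : 𝔸ˣ) : 𝔸) - 1‖ ≤ α₁) →
      (∀ m, 1 ≤ m → m < i.k → ∀ (u₁ : Site d → 𝔸ˣ) (U₁ : Site d → Fin d → 𝔸ˣ) (A : Site d → Fin d → 𝔸),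
        (∀ x, u₁ x ∈ unitaryUnits 𝔸) → (∀ x, x ∉ i.Ω 0 → u₁ x = 1) → mgauge U₀ u₁ U₁ = U' → Restr129 L m (i.Λs m) U₀ u₁ →
        LanF i U₀ φ m U₁ →
        (∀ j, j ≤ m → ∀ b ∈ {b : Site d × Fin d | SideTouches (i.Ω j) b.1 b.2},
        U₁ b.1 b.2 = cfgExp i.η A b.1 b.2 ∧ IsSelfAdjoint (A b.1 b.2) ∧ ‖A b.1 b.2‖ ≤ (5 * (d : ℝ) * L * B₈ * (α₀ + α₁)) * ((L : ℝ) ^ j * i.η)⁻¹) →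
        ∃ (v : Site d → 𝔸ˣ) (lam : Site d → 𝔸), (∀ x, v x ∈ unitaryUnits 𝔸) ∧ (∀ x, x ∉ i.Ω 0 → v x = 1) ∧
        (∀ j, j ≤ m + 1 → ∀ b ∈ {b : Site d × Fin d | SideTouches (i.Ω j) b.1 b.2}, (v b.1 : 𝔸) = ((gaugeExp lam b.1 : 𝔸ˣ) : 𝔸) ∧
        (v (b.1 + e b.2) : 𝔸) = ((gaugeExp lam (b.1 + e b.2) : 𝔸ˣ) : 𝔸)) ∧
        (∀ j, j ≤ m + 1 → ∀ b ∈ {b : Site d × Fin d | SideTouches (i.Ω j) b.1 b.2},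
        ‖lam b.1‖ ≤ (8 * B₀' * (5 * (d : ℝ) * L * B₈) * (α₀ + α₁)) ∧ ((L : ℝ) ^ j * i.η) * ‖covDerivFwd i.η U₀ b.2 lam b.1‖ ≤ (8 * B₀' * (5 * (d : ℝ) * L * B₈) * (α₀ + α₁))) ∧
        LanF i U₀ φ (m + 1) (mgauge U₀ v⁻¹ U₁) ∧ Restr129 L (m + 1) (i.Λs (m + 1)) U₀ (u₁ * v)))
    (SH59src : ∀ i : ZdIdx d L, ∀ α₀ α₁ : ℝ, 0 < α₀ → 0 < α₁ → α₀ + α₁ ≤ cP →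
      ∀ U₀ U' : Site d → Fin d → 𝔸ˣ, (∀ x κ, U₀ x κ ∈ unitaryUnits 𝔸) → (∀ x κ, U' x κ ∈ unitaryUnits 𝔸) →
      ∀ φ : Φ, Adm i φ U₀ α₀ α₁ →
      InAk L i.k i.η α₀ i.Ω U₀ → InAk L i.k i.η α₀ i.Ω (mulCfg U' U₀) → (∀ m, m ≤ i.k → InAx L m (i.Λs m) U₀ (mulCfg U' U₀)) →
      (∀ j, j ≤ i.k → ∀ (z : Site d) (μ : Fin d), (∀ x, InBox (loK L j z) (bondHiK L j z μ) x → x ∈ i.Ω j) →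
        ‖(avgIter L (mulCfg U' U₀) j z μ : 𝔸) - (avgIter L U₀ j z μ : 𝔸)‖ ≤ α₁) →
      (∀ b ∈ {b : Site d × Fin d | SideTouches (i.Ω 0) b.1 b.2}, ‖((U' b.1 b.2 : 𝔸ˣ) : 𝔸) - 1‖ ≤ α₁) →
      (∀ m, 1 ≤ m → m ≤ i.k → ∀ (u : Site d → 𝔸ˣ) (W : Site d → Fin d → 𝔸ˣ) (A' : Site d → Fin d → 𝔸),
        (∀ x, u x ∈ unitaryUnits 𝔸) → mgauge U₀ u W = U' → Restr129 L m (i.Λs m) U₀ u → LanF i U₀ φ m W →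
        (∀ y τ, IsSelfAdjoint (A' y τ)) →
        (∀ j, j ≤ m → ∀ y τ, SideTouches (i.Ω j) y τ →
        W y τ = cfgExp i.η A' y τ ∧ ‖A' y τ‖ ≤ (2 * (L * (5 * (d : ℝ) * L * B₈ * (α₀ + α₁))) + 8 * (8 * B₀' * (5 * (d : ℝ) * L * B₈) * (α₀ + α₁))) * ((L : ℝ) ^ j * i.η)⁻¹) →
        (∀ y τ, (∀ j, j ≤ m → ¬ SideTouches (i.Ω j) y τ) → A' y τ = 0) →
        msup L m i.η (-(1 : ℝ)) (fun j (b : Site d × Fin d) => SideTouches (i.Ω j) b.1 b.2) (fun b => A' b.1 b.2)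
        ≤ B₀ * (bondNorm L m i.η (-(3 : ℝ)) i.Ω (fun x μ => Jcur i.η U₀ A' μ x)
        + wsup 1 (fun p : {p : ℕ × (Site d × Fin d) // p.1 ≤ m ∧ p.2 ∈ i.Λb m p.1} =>
        linCovIter L U₀ (iEta i.η A') p.1.1 p.1.2.1 p.1.2.2)) + γ' * B₀ * (α₀ + α₁) ∧
        msup L m i.η (-(2 : ℝ)) (fun j (t : Fin d × Fin d × Site d) => SideTouches (i.Ω j) t.2.2 t.2.1)
        (fun t => covDerivFwd i.η U₀ t.1 (fun z => A' z t.2.1) t.2.2)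
        ≤ B₀ * (bondNorm L m i.η (-(3 : ℝ)) i.Ω (fun x μ => Jcur i.η U₀ A' μ x)
        + wsup 1 (fun p : {p : ℕ × (Site d × Fin d) // p.1 ≤ m ∧ p.2 ∈ i.Λb m p.1} =>
        linCovIter L U₀ (iEta i.η A') p.1.1 p.1.2.1 p.1.2.2)) + γ' * B₀ * (α₀ + α₁)))
    (SP5u : ∀ i : ZdIdx d L, ∀ α₀ α₁ : ℝ, 0 < α₀ → 0 < α₁ → α₀ + α₁ ≤ cP →
      ∀ U₀ U' : Site d → Fin d → 𝔸ˣ, (∀ x κ, U₀ x κ ∈ unitaryUnits 𝔸) → (∀ x κ, U' x κ ∈ unitaryUnits 𝔸) →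
      ∀ φ : Φ, Adm i φ U₀ α₀ α₁ →
      InAk L i.k i.η α₀ i.Ω U₀ → InAk L i.k i.η α₀ i.Ω (mulCfg U' U₀) → (∀ m, m ≤ i.k → InAx L m (i.Λs m) U₀ (mulCfg U' U₀)) →
      (∀ j, j ≤ i.k → ∀ (z : Site d) (μ : Fin d), (∀ x, InBox (loK L j z) (bondHiK L j z μ) x → x ∈ i.Ω j) →
        ‖(avgIter L (mulCfg U' U₀) j z μ : 𝔸) - (avgIter L U₀ j z μ : 𝔸)‖ ≤ α₁) →
      (∀ b ∈ {b : Site d × Fin d | SideTouches (i.Ω 0) b.1 b.2}, ‖((U' b.1 b.2 : 𝔸ˣ) : 𝔸) - 1‖ ≤ α₁) →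
      ∀ u₁ : Site d → 𝔸ˣ, (∀ x, u₁ x ∈ unitaryUnits 𝔸) → (∀ x, x ∉ i.Ω 0 → u₁ x = 1) → Restr129 L i.k (i.Λs i.k) U₀ u₁ →
      LanF i U₀ φ i.k (mgauge U₀ u₁⁻¹ U') →
      (∃ A₁ : Site d → Fin d → 𝔸, ∀ j, j ≤ i.k → ∀ (x : Site d) (κ : Fin d), SideTouches (i.Ω j) x κ →
        mgauge U₀ u₁⁻¹ U' x κ = cfgExp i.η A₁ x κ ∧ ‖A₁ x κ‖ ≤ (5 * (d : ℝ) * L * B₈ * (α₀ + α₁)) * ((L : ℝ) ^ j * i.η)⁻¹) →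
      ∀ (v w : Site d → 𝔸ˣ) (lam mu : Site d → 𝔸),
      (∀ x, ((gaugeExp lam x : 𝔸ˣ) : 𝔸) = ((v x : 𝔸ˣ) : 𝔸) ∧ IsSelfAdjoint (lam x) ∧ ‖lam x‖ < cu) → (∀ x, x ∉ i.Ω 0 → lam x = 0) →
      (∀ j, j ≤ i.k → ∀ b ∈ {b : Site d × Fin d | SideTouches (i.Ω j) b.1 b.2}, ((L : ℝ) ^ j * i.η) * ‖covDerivFwd i.η U₀ b.2 lam b.1‖ < cu) →
      (∀ x, ((gaugeExp mu x : 𝔸ˣ) : 𝔸) = ((w x : 𝔸ˣ) : 𝔸) ∧ IsSelfAdjoint (mu x) ∧ ‖mu x‖ < cu) → (∀ x, x ∉ i.Ω 0 → mu x = 0) →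
      (∀ j, j ≤ i.k → ∀ b ∈ {b : Site d × Fin d | SideTouches (i.Ω j) b.1 b.2}, ((L : ℝ) ^ j * i.η) * ‖covDerivFwd i.η U₀ b.2 mu b.1‖ < cu) →
      LanF i U₀ φ i.k (mgauge U₀ v⁻¹ (mgauge U₀ u₁⁻¹ U')) → Restr129 L i.k (i.Λs i.k) U₀ (u₁ * v) →
      LanF i U₀ φ i.k (mgauge U₀ w⁻¹ (mgauge U₀ u₁⁻¹ U')) → Restr129 L i.k (i.Λs i.k) U₀ (u₁ * w) →
      ∀ x, v x = w x) :
    ∃ c₁ : ℝ, 0 < c₁ ∧ ∀ i : ZdIdx d L, ∀ α₀ α₁ : ℝ, 0 < α₀ → 0 < α₁ → α₀ + α₁ ≤ c₁ →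
      ∀ (U₀ : (zdGF3 𝔸 L β len i).Cfg) (P : (zdGF3 𝔸 L β len i).Pert) (φ : Φ), Adm i φ U₀.1 α₀ α₁ →
        (zdGF3 𝔸 L β len i).InA α₀ U₀ → (zdGF3 𝔸 L β len i).InAAx α₀ U₀ P → (zdGF3 𝔸 L β len i).avgClose166 α₁ U₀ P →
        ∃ u : (zdGF3 𝔸 L β len i).GT, (zdGF3 𝔸 L β len i).Restricted U₀ u ∧
          ((zdGF3 𝔸 L β len i).C137 α₁ U₀ ((zdGF3 𝔸 L β len i).act P u) ∧
            LanF i U₀.1 φ i.k ((zdGF3 𝔸 L β len i).act P u).2.1 ∧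
            (zdGF3 𝔸 L β len i).C162 (5 * (d : ℝ) * L * B₈) (α₀ + α₁) U₀ ((zdGF3 𝔸 L β len i).act P u)) ∧
          ∀ u' : (zdGF3 𝔸 L β len i).GT, (zdGF3 𝔸 L β len i).Restricted U₀ u' →
            LanF i U₀.1 φ i.k ((zdGF3 𝔸 L β len i).act P u').2.1 →
            (zdGF3 𝔸 L β len i).C162 (5 * (d : ℝ) * L * B₈) (α₀ + α₁) U₀ ((zdGF3 𝔸 L β len i).act P u') → u' = u := by
  have hL1 : 1 ≤ L := le_trans (by norm_num) hL
  have hd1 : 1 ≤ d := le_trans (by norm_num) hd2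
  have hL' : (1 : ℝ) ≤ L := by exact_mod_cast hL1
  obtain ⟨c₁, hc₁, H⟩ := thm4Body_concrete_uniform_lanE (𝔸 := 𝔸) hd2 hL hB₀ hB₀' hcu hcP (Φ := Φ) hγ' hB₈ hB₀8 hB hγB
  obtain ⟨cw, hcw, hw⟩ := thm4_windows hd1 hL1 hB₈ hB₀' hB
  obtain ⟨cw', hcw', hw'⟩ := thm4_windows_extra (d := d) hL1
  refine ⟨min c₁ (min cw cw'), lt_min hc₁ (lt_min hcw hcw'), ?_⟩
  intro i α₀ α₁ hα₀ hα₁ hs U₀ P φ hφ hInA hInAAx h166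
  have hs₁ : α₀ + α₁ ≤ c₁ := hs.trans (min_le_left _ _)
  have hsw : α₀ + α₁ ≤ cw := hs.trans ((min_le_right _ _).trans (min_le_left _ _))
  have hsw' : α₀ + α₁ ≤ cw' := hs.trans ((min_le_right _ _).trans (min_le_right _ _))
  obtain ⟨hP1, h34, hAx⟩ := hInAAx
  obtain ⟨h135, h66⟩ := h166
  subst hP1
  obtain ⟨u, hu, huS, h129, hLan, hleaf, huniq⟩ := H (Adm i) (LanF i) i.η i.hη i.k i.Ω i.hΩ i.Λs i.Λb i.hbox i.hclass i.htower i.hpart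
    (SP5base i) (SP5 i) (SH59src i) (SP5u i) α₀ α₁ hα₀ hα₁ hs₁ P.1.1 P.2.1 P.1.2 P.2.2 φ hφ hInA h34 hAx h135 h66
  -- windows for the (1.42) lemma (at the enlarged constant `B₈`)
  obtain ⟨-, -, -, -, w5, w6, w7, -, w9, w10, -, -, -, -, -, -, -, -⟩ :=
    hw α₀ α₁ hα₀ hα₁ hsw (5 * (d : ℝ) * L * B₈ * (α₀ + α₁)) (8 * B₀' * (5 * (d : ℝ) * L * B₈) * (α₀ + α₁)) rfl rfl
  obtain ⟨w19, -⟩ := hw' α₀ α₁ hα₀ hα₁ hsw'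
  have hcs0 : 0 ≤ 5 * (d : ℝ) * L * B₈ * (α₀ + α₁) := by positivity
  have hKS0 : 0 ≤ 2 * (L * (5 * (d : ℝ) * L * B₈ * (α₀ + α₁))) + 8 * (8 * B₀' * (5 * (d : ℝ) * L * B₈) * (α₀ + α₁)) := by
    positivity
  have hcK : 5 * (d : ℝ) * L * B₈ * (α₀ + α₁) ≤
      2 * (L * (5 * (d : ℝ) * L * B₈ * (α₀ + α₁))) + 8 * (8 * B₀' * (5 * (d : ℝ) * L * B₈) * (α₀ + α₁)) := by
    have h₁ : (1 : ℝ) * (5 * (d : ℝ) * L * B₈ * (α₀ + α₁)) ≤ L * (5 * (d : ℝ) * L * B₈ * (α₀ + α₁)) :=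
      mul_le_mul_of_nonneg_right hL' hcs0
    have h₂ : 0 ≤ 8 * (8 * B₀' * (5 * (d : ℝ) * L * B₈) * (α₀ + α₁)) := by positivity
    linarith
  have hc16 : 16 * (5 * (d : ℝ) * L * B₈ * (α₀ + α₁)) ≤ 1 := by linarith
  -- the gauge-fixed field and its CANONICAL masked exponent
  have hW : mgauge P.1.1 u (mgauge P.1.1 u⁻¹ P.2.1) = P.2.1 := mgauge_mgauge_inv P.1.1 P.2.1 u
  have hWu : ∀ x κ, mgauge P.1.1 u⁻¹ P.2.1 x κ ∈ unitaryUnits 𝔸 := mem_unitaryUnits_of_mgauge_eq P.1.2 P.2.2 hu hW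
  have hWA : ∀ j, j ≤ i.k → ∀ y τ, SideTouches (i.Ω j) y τ →
      mgauge P.1.1 u⁻¹ P.2.1 y τ = cfgExp i.η (logCfg i.η (mgauge P.1.1 u⁻¹ P.2.1)) y τ ∧
        ‖logCfg i.η (mgauge P.1.1 u⁻¹ P.2.1) y τ‖ ≤ (5 * (d : ℝ) * L * B₈ * (α₀ + α₁)) * ((L : ℝ) ^ j * i.η)⁻¹ :=
    fun j hj y τ h => ⟨(hleaf j hj (y, τ) h).1, (hleaf j hj (y, τ) h).2.2⟩
  obtain ⟨hA'sa, hA'eq, hA'zero⟩ := mlogCfg_spec i.hη hL1 i.k P.1.1 hWu hcs0 hc16 i.Ω hWA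
  set A' := mlogCfg i.k i.η i.Ω (mgauge P.1.1 u⁻¹ P.2.1) with hA'_def
  have hA'bd : ∀ j, j ≤ i.k → ∀ y τ, SideTouches (i.Ω j) y τ →
      mgauge P.1.1 u⁻¹ P.2.1 y τ = cfgExp i.η A' y τ ∧
        ‖A' y τ‖ ≤ (2 * (L * (5 * (d : ℝ) * L * B₈ * (α₀ + α₁))) + 8 * (8 * B₀' * (5 * (d : ℝ) * L * B₈) * (α₀ + α₁))) *
          ((L : ℝ) ^ j * i.η)⁻¹ := by
    intro j hj y τ h
    obtain ⟨hAA, hWexp⟩ := hA'eq j hj y τ h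
    refine ⟨hWexp, ?_⟩
    rw [hAA]
    have hη0 : 0 ≤ i.η := i.hη.le
    exact ((hWA j hj y τ h).2).trans (mul_le_mul_of_nonneg_right hcK (by positivity))
  have h137 := B8Eq142KLevelLocal.H42_of_inAx hd2 i.hη hL i.k P.1.2 hα₀ hα₁ hKS0 w5 w6 w7 w9 w10 w19 i.Ω i.hΩ i.Λs i.Λb i.hbox
    i.hclass hInA h34 hAx h135 (fun m W => LanF i P.1.1 φ m W) i.k i.hk le_rfl u
    (mgauge P.1.1 u⁻¹ P.2.1) A' hu hW h129 (hLan i.hk) hA'sa hA'bd hA'zero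
  refine ⟨⟨u, hu, huS⟩, h129, ⟨h137, hLan i.hk, ?_⟩, ?_⟩
  · intro j hj b hb
    exact hleaf j hj b hb
  · intro u' hR' hLan' h162'
    apply Subtype.ext
    refine huniq u'.1 u'.2.1 u'.2.2 hR' hLan' ⟨logCfg i.η (mgauge P.1.1 u'.1⁻¹ P.2.1), fun j hj x κ h => ?_⟩ i.hk
    exact ⟨(h162' j hj (x, κ) h).1, (h162' j hj (x, κ) h).2.2⟩

end Core

#print axioms thm4Core_zd3_lanE

end Literature.MathematicalPhysics.QuantumFieldTheory.Balaban1983to89.B8Thm4CoreZd3LanE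

end
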